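import Mathlib
import Summits.Ventures.PercRepro.TriangleCapRowPlusFiveA
import Summits.Ventures.PercRepro.TriangleCapRowPlusFiveB

/-!
# PercRepro — THE CELL `(14, 19)` OF THE `K₄⁻`-FREE CHERRY TABLE (`t = 6`, part C) AND THE ROW `m = k + 5` EXACT FOR EVERY `k ≥ 9`
(p3, gen 32; part 22 — the last cell, the six exact cells and the row)

The row `t = 6` (`m = k + 5`) is the star value `C(k − 1, 2) + 12` from the threshold `k = 18` on and the bipartite
value `C(k − 1, 2) + 12 + j` at `k = 18 − j` for `j ≤ 3` (TriangleCapBelowThreshold); the cells `k = 9 … 14` are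
`K_{2,7}` plus `k − 9` pendant edges (`49, 56, 64, 73, 83, 94`; the census holds `49` and `56`).  Each closes by
TriangleCapSevenTen's cell template — the count at a vertex of maximum degree `d`: `d ≤ 4` by the degree cap
`3m`; the dominating `d = k − 1` by `T = |R| = 12 > d` (`k ≤ 12`); `d ≥ 8` by the matching pairs alone
(`Y ≥ 5T`: a matching pair is avoided by `≥ m′ + d − k = t − 1 = 5` edges off `v`); `d = 5, 6, 7` by the defect sum
seen from a vertex of maximum off-degree `δ ≥ 5`, or the split sum `Y ≥ 5T + (|R| − T)(m′ + 1 − 2δ)` for `δ ≤ 4`.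
This file: `k = 14` (the dominating case has `T = 12 ≤ d` and closes by `T² ≤ 2Y + 2T`),
the six exact cells and **`row_plus_five_from_nine`**: the row `m = k + 5` is exactly `C(k − 1, 2) + 12 + (18 − k)` for
every `k ≥ 9`.  Axioms: standard.
-/

namespace PercRepro

namespace TriangleCap

namespace C047

open Finset

variable {V : Type*} [Fintype V] [DecidableEq V]

/-- **THE CELL `(14, 19)`, THE BOUND:** every `K₄⁻`-free graph with `19` edges on `14` vertices has
`Σ_v C(d(v), 2) ≤ 94`. -/
theorem cherries_le_ninety_four_of_k4mFree (D : SimpleGraph V) [DecidableRel D.Adj] (hK : K4mFree D)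
    (hk : Fintype.card V = 14) (hm : D.edgeFinset.card = 19) : cherries D ≤ 94 := by
  by_cases hdeg : ∀ v, deg D v ≤ 4
  · -- every degree `≤ 4`: `2·cherries ≤ 3 Σ d = 6m`
    have h2 : 2 * cherries D ≤ (4 - 1) * ∑ v, deg D v := by
      unfold cherries
      rw [mul_sum, mul_sum]
      exact sum_le_sum (fun v _ => two_mul_choose_two_le_pred_mul _ _ (hdeg v))
    rw [sum_deg_eq, hm] at h2
    omega
  · push Not at hdeg
    obtain ⟨u, hu⟩ := hdeg
    obtain ⟨v, -, hmax⟩ := exists_max_image univ (deg D) ⟨u, mem_univ u⟩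
    have hmax' : ∀ w, deg D w ≤ deg D v := fun w => hmax w (mem_univ w)
    have hv : 5 ≤ deg D v := by
      have := hmax' u
      omega
    have hS := sum_adjPairsAll_deg_add D
    have hsplit1 := sum_filter_add_sum_filter_not (adjPairsAll D) (fun p => p.1 = v)
      (fun p => deg D p.1 + deg D p.2)
    have hsplit2 := sum_filter_add_sum_filter_not ((adjPairsAll D).filter (fun p => ¬ p.1 = v))
      (fun p => p.2 = v) (fun p => deg D p.1 + deg D p.2)
    rw [filter_not_fst_filter_snd, filter_not_fst_filter_not_snd] at hsplit2
    have hfst := sum_filter_fst_deg_add D v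
    have hsnd := sum_filter_snd_deg_add D v
    have hA := sum_deg_neighbors_eq D v
    have hE := two_mul_card_E_le D v
    have hT := card_T_le_deg D hK v
    have hTT := card_T_mul_card_T_le D hK v
    have hRc := two_mul_card_edges_eq D v
    have hR1 := sum_R_add_sum_avoid_le D v
    have hc := two_mul_cherries_add D
    rw [sum_deg_eq] at hc
    have hdk : deg D v + 1 ≤ Fintype.card V := by
      have hsub : univ.filter (fun w => D.Adj v w) ⊆ univ.erase v := by
        intro w hw
        rw [mem_filter] at hw
        rw [mem_erase]
        exact ⟨(D.ne_of_adj hw.2).symm, mem_univ _⟩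
      have h1 : deg D v ≤ (univ.erase v).card := card_le_card hsub
      rw [card_erase_of_mem (mem_univ v), card_univ] at h1
      have h2 : 1 ≤ Fintype.card V := Fintype.card_pos_iff.mpr ⟨v⟩
      omega
    have hmain : 2 * (∑ x, deg D x * deg D x) + (offPairs D v).card * deg D v +
        ∑ p ∈ offPairs D v, (avoid D v p).card ≤
        2 * (deg D v * deg D v) + 2 * deg D v +
          4 * ((offPairs D v).filter (fun p => D.Adj v p.1)).card +
          (offPairs D v).card * D.edgeFinset.card + (offPairs D v).card := by
      linarith [hS, hsplit1, hsplit2, hfst, hsnd, hA, hR1]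
    have hdom : deg D v + 1 = Fintype.card V →
        ((offPairs D v).filter (fun p => D.Adj v p.1 ∧ D.Adj v p.2)).card = (offPairs D v).card :=
      fun h => congrArg card (filter_T_eq_offPairs_of_deg_add_one_eq_card D h)
    have hEc := card_offEdges D v
    obtain ⟨c, -, hcmax⟩ := exists_max_image univ (outDeg D v) ⟨v, mem_univ v⟩
    have hcmax' : ∀ w, outDeg D v w ≤ outDeg D v c := fun w => hcmax w (mem_univ w)
    have hδd : outDeg D v c ≤ deg D v := (outDeg_le_deg D v c).trans (hmax' c)
    have hδ1 := sum_avoid_ge_of_outDeg D v c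
    have hL := sum_avoid_ge_of_T_of_outDeg_le D hK v (outDeg D v c) hcmax'
    set T := ((offPairs D v).filter (fun p => D.Adj v p.1 ∧ D.Adj v p.2)).card with hTdef
    set E := ((offPairs D v).filter (fun p => D.Adj v p.1)).card with hEdef
    set Rc := (offPairs D v).card with hRcdef
    set Y := ∑ p ∈ offPairs D v, (avoid D v p).card with hYdef
    set Ec := (offEdges D v).card with hEcdef
    set δ := outDeg D v c with hδdef
    set d := deg D v with hddef
    set m := D.edgeFinset.card with hmdef
    set k := Fintype.card V with hkdef
    set ch := cherries D with hchdef
    set s2 := ∑ x, deg D x * deg D x with hs2def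
    clear_value T E Rc Y Ec δ d m k ch s2
    have hfin : 2 * s2 + Rc * d + Y ≤ 2 * (d * d) + 2 * d + 2 * Rc + 2 * T + Rc * m + Rc := by
      linarith [hmain, hE]
    clear hmain hS hsplit1 hsplit2 hfst hsnd hA hR1 hE hTdef hEdef hRcdef hYdef hEcdef hδdef hddef
      hmdef hkdef hchdef hs2def hmax hmax' hcmax hcmax' hu
    subst hk hm
    obtain ⟨a, rfl⟩ : ∃ a, d = 5 + a := ⟨d - 5, by omega⟩
    rcases (by omega : a = 0 ∨ a = 1 ∨ a = 2 ∨ a = 3 ∨ a = 4 ∨ a = 5 ∨ a = 6 ∨ a = 7 ∨ a = 8) with rfl | rfl | rfl | rfl | rfl | rfl | rfl | rfl | rfl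
    · -- maximum degree `5`: `|R| = 28`, `m′ = 14`
      have hRc' : Rc = 28 := by omega
      have hEc' : Ec = 14 := by omega
      subst hRc' hEc'
      have hY : 2 * T + 84 ≤ Y := by
        by_cases hδ5 : 5 ≤ δ
        · have hδ' : δ = 5 := by omega
          subst hδ'
          omega
        · have h1 : (28 - T) * (14 - 7) ≤ (28 - T) * (14 + 1 - 2 * δ) := Nat.mul_le_mul_left _ (by omega)
          omega
      omega
    · -- maximum degree `6`: `|R| = 26`, `m′ = 13`
      have hRc' : Rc = 26 := by omega
      have hEc' : Ec = 13 := by omega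
      subst hRc' hEc'
      have hY : 2 * T + 48 ≤ Y := by
        by_cases hδ5 : 5 ≤ δ
        · rcases (by omega : δ = 5 ∨ δ = 6) with hδ' | hδ' <;> subst hδ' <;> omega
        · have h1 : (26 - T) * (13 - 7) ≤ (26 - T) * (13 + 1 - 2 * δ) := Nat.mul_le_mul_left _ (by omega)
          omega
      omega
    · -- maximum degree `7`: `|R| = 24`, `m′ = 12`
      have hRc' : Rc = 24 := by omega
      have hEc' : Ec = 12 := by omega
      subst hRc' hEc'
      have hY : 2 * T + 20 ≤ Y := by
        by_cases hδ5 : 5 ≤ δ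
        · rcases (by omega : δ = 5 ∨ δ = 6 ∨ δ = 7) with hδ' | hδ' | hδ' <;> subst hδ' <;> omega
        · have h1 : (24 - T) * (12 - 7) ≤ (24 - T) * (12 + 1 - 2 * δ) := Nat.mul_le_mul_left _ (by omega)
          omega
      omega
    · -- maximum degree `8`: `|R| = 22`, `m′ = 11`
      have hRc' : Rc = 22 := by omega
      have hEc' : Ec = 11 := by omega
      subst hRc' hEc'
      have h0 := Nat.zero_le ((22 - T) * (11 + 1 - 2 * δ))
      omega
    · -- maximum degree `9`: `|R| = 20`, `m′ = 10`
      have hRc' : Rc = 20 := by omega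
      have hEc' : Ec = 10 := by omega
      subst hRc' hEc'
      have h0 := Nat.zero_le ((20 - T) * (10 + 1 - 2 * δ))
      omega
    · -- maximum degree `10`: `|R| = 18`, `m′ = 9`
      have hRc' : Rc = 18 := by omega
      have hEc' : Ec = 9 := by omega
      subst hRc' hEc'
      have h0 := Nat.zero_le ((18 - T) * (9 + 1 - 2 * δ))
      omega
    · -- maximum degree `11`: `|R| = 16`, `m′ = 8`
      have hRc' : Rc = 16 := by omega
      have hEc' : Ec = 8 := by omega
      subst hRc' hEc'
      have h0 := Nat.zero_le ((16 - T) * (8 + 1 - 2 * δ))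
      omega
    · -- maximum degree `12`: `|R| = 14`, `m′ = 7`
      have hRc' : Rc = 14 := by omega
      have hEc' : Ec = 7 := by omega
      subst hRc' hEc'
      have h0 := Nat.zero_le ((14 - T) * (7 + 1 - 2 * δ))
      omega
    · -- maximum degree `13`: `|R| = 12`, `m′ = 6`
      have hT2 := hdom (by omega)
      have hRc' : Rc = 12 := by omega
      subst hRc'
      subst hT2
      omega

/-- **THE CELL `(9, 14) = 49`, EXACT:** `K_{2,7}` plus `0` pendant edge(s) (`bipPend 9 6`) attains the bound. -/
theorem nine_fourteen_exact :
    (∀ (D : SimpleGraph (Fin 9)) [DecidableRel D.Adj], K4mFree D → D.edgeFinset.card = 14 →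
        cherries D ≤ 49) ∧
      ∃ (D : SimpleGraph (Fin 9)) (_ : DecidableRel D.Adj),
        K4mFree D ∧ D.edgeFinset.card = 14 ∧ cherries D = 49 := by
  refine ⟨fun D _ hK hD => cherries_le_forty_nine_of_k4mFree D hK (by simp) hD,
    bipPend 9 6, inferInstance, k4mFree_bipPend 9 6, ?_, ?_⟩
  · have := card_edges_bipPend 9 6 (by norm_num)
    omega
  · rw [cherries_bipPend 9 6 (by norm_num)]
    decide

/-- **THE CELL `(10, 15) = 56`, EXACT:** `K_{2,7}` plus `1` pendant edge(s) (`bipPend 10 6`) attains the bound. -/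
theorem ten_fifteen_exact :
    (∀ (D : SimpleGraph (Fin 10)) [DecidableRel D.Adj], K4mFree D → D.edgeFinset.card = 15 →
        cherries D ≤ 56) ∧
      ∃ (D : SimpleGraph (Fin 10)) (_ : DecidableRel D.Adj),
        K4mFree D ∧ D.edgeFinset.card = 15 ∧ cherries D = 56 := by
  refine ⟨fun D _ hK hD => cherries_le_fifty_six_of_k4mFree D hK (by simp) hD,
    bipPend 10 6, inferInstance, k4mFree_bipPend 10 6, ?_, ?_⟩
  · have := card_edges_bipPend 10 6 (by norm_num)
    omega
  · rw [cherries_bipPend 10 6 (by norm_num)]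
    decide

/-- **THE CELL `(11, 16) = 64`, EXACT:** `K_{2,7}` plus `2` pendant edge(s) (`bipPend 11 6`) attains the bound. -/
theorem eleven_sixteen_exact :
    (∀ (D : SimpleGraph (Fin 11)) [DecidableRel D.Adj], K4mFree D → D.edgeFinset.card = 16 →
        cherries D ≤ 64) ∧
      ∃ (D : SimpleGraph (Fin 11)) (_ : DecidableRel D.Adj),
        K4mFree D ∧ D.edgeFinset.card = 16 ∧ cherries D = 64 := by
  refine ⟨fun D _ hK hD => cherries_le_sixty_four_of_k4mFree D hK (by simp) hD,
    bipPend 11 6, inferInstance, k4mFree_bipPend 11 6, ?_, ?_⟩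
  · have := card_edges_bipPend 11 6 (by norm_num)
    omega
  · rw [cherries_bipPend 11 6 (by norm_num)]
    decide

/-- **THE CELL `(12, 17) = 73`, EXACT:** `K_{2,7}` plus `3` pendant edge(s) (`bipPend 12 6`) attains the bound. -/
theorem twelve_seventeen_exact :
    (∀ (D : SimpleGraph (Fin 12)) [DecidableRel D.Adj], K4mFree D → D.edgeFinset.card = 17 →
        cherries D ≤ 73) ∧
      ∃ (D : SimpleGraph (Fin 12)) (_ : DecidableRel D.Adj),
        K4mFree D ∧ D.edgeFinset.card = 17 ∧ cherries D = 73 := by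
  refine ⟨fun D _ hK hD => cherries_le_seventy_three_of_k4mFree D hK (by simp) hD,
    bipPend 12 6, inferInstance, k4mFree_bipPend 12 6, ?_, ?_⟩
  · have := card_edges_bipPend 12 6 (by norm_num)
    omega
  · rw [cherries_bipPend 12 6 (by norm_num)]
    decide

/-- **THE CELL `(13, 18) = 83`, EXACT:** `K_{2,7}` plus `4` pendant edge(s) (`bipPend 13 6`) attains the bound. -/
theorem thirteen_eighteen_exact :
    (∀ (D : SimpleGraph (Fin 13)) [DecidableRel D.Adj], K4mFree D → D.edgeFinset.card = 18 →
        cherries D ≤ 83) ∧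
      ∃ (D : SimpleGraph (Fin 13)) (_ : DecidableRel D.Adj),
        K4mFree D ∧ D.edgeFinset.card = 18 ∧ cherries D = 83 := by
  refine ⟨fun D _ hK hD => cherries_le_eighty_three_of_k4mFree D hK (by simp) hD,
    bipPend 13 6, inferInstance, k4mFree_bipPend 13 6, ?_, ?_⟩
  · have := card_edges_bipPend 13 6 (by norm_num)
    omega
  · rw [cherries_bipPend 13 6 (by norm_num)]
    decide

/-- **THE CELL `(14, 19) = 94`, EXACT:** `K_{2,7}` plus `5` pendant edge(s) (`bipPend 14 6`) attains the bound. -/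
theorem fourteen_nineteen_exact :
    (∀ (D : SimpleGraph (Fin 14)) [DecidableRel D.Adj], K4mFree D → D.edgeFinset.card = 19 →
        cherries D ≤ 94) ∧
      ∃ (D : SimpleGraph (Fin 14)) (_ : DecidableRel D.Adj),
        K4mFree D ∧ D.edgeFinset.card = 19 ∧ cherries D = 94 := by
  refine ⟨fun D _ hK hD => cherries_le_ninety_four_of_k4mFree D hK (by simp) hD,
    bipPend 14 6, inferInstance, k4mFree_bipPend 14 6, ?_, ?_⟩
  · have := card_edges_bipPend 14 6 (by norm_num)
    omega
  · rw [cherries_bipPend 14 6 (by norm_num)]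
    decide

/-- **THE ROW `m = k + 5`, EXACT FOR EVERY `k ≥ 9`:** the maximum is `C(k − 1, 2) + 12 + (18 − k)` — `49, 56, 64, 73, 83, 94`
at `k = 9 … 14` and `106, 119, 133` at `k = 15, 16, 17` (`K_{2,7}` plus `k − 9` pendant edges), the star value
`C(k − 1, 2) + 12` from `k = 18` on. -/
theorem row_plus_five_from_nine (k : ℕ) (hk : 9 ≤ k) :
    (∀ (D : SimpleGraph (Fin k)) [DecidableRel D.Adj], K4mFree D → D.edgeFinset.card = k + 5 →
        cherries D ≤ (k - 1).choose 2 + 12 + (18 - k)) ∧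
      ∃ (D : SimpleGraph (Fin k)) (_ : DecidableRel D.Adj), K4mFree D ∧ D.edgeFinset.card = k + 5 ∧
        cherries D = (k - 1).choose 2 + 12 + (18 - k) := by
  rcases (by omega : k = 9 ∨ k = 10 ∨ k = 11 ∨ k = 12 ∨ k = 13 ∨ k = 14 ∨ (15 ≤ k ∧ k ≤ 17) ∨ 18 ≤ k)
    with rfl | rfl | rfl | rfl | rfl | rfl | ⟨h15, h17⟩ | h18
  · obtain ⟨h1, D, inst, hK, hD, hc⟩ := nine_fourteen_exact
    have e : (9 - 1).choose 2 = 28 := by decide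
    exact ⟨fun D _ hK hD => by have := h1 D hK hD; omega, D, inst, hK, hD, by omega⟩
  · obtain ⟨h1, D, inst, hK, hD, hc⟩ := ten_fifteen_exact
    have e : (10 - 1).choose 2 = 36 := by decide
    exact ⟨fun D _ hK hD => by have := h1 D hK hD; omega, D, inst, hK, hD, by omega⟩
  · obtain ⟨h1, D, inst, hK, hD, hc⟩ := eleven_sixteen_exact
    have e : (11 - 1).choose 2 = 45 := by decide
    exact ⟨fun D _ hK hD => by have := h1 D hK hD; omega, D, inst, hK, hD, by omega⟩
  · obtain ⟨h1, D, inst, hK, hD, hc⟩ := twelve_seventeen_exact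
    have e : (12 - 1).choose 2 = 55 := by decide
    exact ⟨fun D _ hK hD => by have := h1 D hK hD; omega, D, inst, hK, hD, by omega⟩
  · obtain ⟨h1, D, inst, hK, hD, hc⟩ := thirteen_eighteen_exact
    have e : (13 - 1).choose 2 = 66 := by decide
    exact ⟨fun D _ hK hD => by have := h1 D hK hD; omega, D, inst, hK, hD, by omega⟩
  · obtain ⟨h1, D, inst, hK, hD, hc⟩ := fourteen_nineteen_exact
    have e : (14 - 1).choose 2 = 78 := by decide
    exact ⟨fun D _ hK hD => by have := h1 D hK hD; omega, D, inst, hK, hD, by omega⟩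
  · obtain ⟨h1, h2⟩ := rows_below_exact 6 k (18 - k) (by norm_num) (by omega) (by omega)
    exact ⟨fun D _ hK hD => by have := h1 D hK (by omega); omega, by
      obtain ⟨D, inst, hK, hD, hc⟩ := h2
      exact ⟨D, inst, hK, by omega, by omega⟩⟩
  · obtain ⟨h1, h2⟩ := rows_exact 6 k (by norm_num) (by omega) (by omega)
    have e : 18 - k = 0 := by omega
    rw [e]
    exact ⟨fun D _ hK hD => by have := h1 D hK (by omega); omega, by
      obtain ⟨D, inst, hK, hD, hc⟩ := h2
      exact ⟨D, inst, hK, by omega, by omega⟩⟩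

end C047

end TriangleCap

end PercRepro
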